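import Summits.RiemannHypothesis.RiemannHypothesis.Theses.DisplacementPencil
import Summits.RiemannHypothesis.RiemannHypothesis.Theorems.PencilDoubling.Negative.DisplacementPencilPencilDoublingTargetOrBust

/-!
# Birth skeleton (BC3) — crux `PencilDoubling` (stmt-RiemannHypothesis-17887), route `DisplacementPencil`

Crux (route decl, verbatim): for every `c ≥ 4`, if the rung
`P_c(z) = c·Ξ(z) + Ξ(z+i) + Ξ(z−i)` has only real zeros ("`Hyp c`") then some rung `P_{c'}` with
`c' ≥ 2c` has only real zeros.

Line `birth` = the route's own TWO-LAYER PLAN for this node ("PencilDoubling ⇐ Low → BandHigh"),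
in STRICT-DOUBLING shape `c' := 2c`, with the provable far field split off as the route's support
item `HighReal` (stmt-RiemannHypothesis-17890).  The zeros of the new rung `P_{2c}` are cut into
three height regimes:

* `stub_low` — LOW REGION / PINNING (`|Re z| < c²`, i.e. `λ = t/(2c)² < 1/4`, where `2c·Ξ`
  dominates the displaced comb away from the tiny lobes of `Z`): for `c ≥ 4` with `Hyp c`, every
  zero of `P_{2c}` with `|Re z| < c²` is real.  This is the stub that USES the hypothesis `Hyp c`
  (both rungs are pinned to the same zeros of `Ξ`).  Caveat built into the route's own numerics and
  made precise by the refuter: in the normal form `p_c = −c·Z + D` a tiny lobe of `Z` survives at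
  weight `c` either because the carrier wins at its extremum (`c ≥ c_hi ≈ |D|/|Z_ext|`; then `2c`
  wins with more margin) or because the comb `D` wins outright around it (`c ≤ c_lo`; the zeros there
  are the comb's, real by monotone phase) — and doubling can carry `c` from below `c_lo` INTO the
  kill window `(c_lo, c_hi)` of a flood-signed close pair, where the pair of real zeros is lost.
  Size: open (and numerically threatened, see below).
* `stub_band` — CROSSOVER BAND BELOW ANY CERTIFIED DOMINANCE HEIGHT: for every `A` such that all
  zeros of every rung `P_{c'}`, `c' ≥ 1`, with `|Re z| ≥ A·c'⁴` are real, and every `c ≥ 4` with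
  `Hyp c`: every zero of `P_{2c}` with `c² ≤ |Re z| < A·(2c)⁴` is real ("band protection": the
  mixture of `Z` with its de Bruijn-regularised companion keeps every lobe signed; numerically clean
  for `c ≤ 32`, kit j020899/j021263).  Size: open.
* `stub_highReal` — EXPLICIT DOMINANCE, verbatim the route's support item `HighReal`: there is `A`
  such that for every `c ≥ 1` all zeros of `P_c` with `|Re z| ≥ A·c⁴` are real (displaced terms beat
  `c·Ξ` at every carrier extremum by `|ζ(1/2+it)| ≪ t^{1/6} log t` or the convexity bound, and the
  phase of `Ξ(t−i)` is strictly monotone).  Size: M/L (explicit ζ estimates not in Mathlib).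

`PencilDoubling_of (hhigh : Sig.stub_highReal) (hband : Sig.stub_band) (hlow : Sig.stub_low) :
PencilDoubling` is the sorry-free composition (take `c' = 2c`; obtain the dominance height `A`
from `stub_highReal`; trichotomy of `|Re z|` against `c²` and `A·(2c)⁴`), and
`PencilDoubling_proof : PencilDoubling := PencilDoubling_of stub_highReal stub_band stub_low`
concludes the crux BY NAME.  Sorries: exactly `stub_low`, `stub_band`, `stub_highReal`.

Shape (tree convention, cf. `Cruxes/AhfHighReal/Lines/birth.lean`, `Cruxes/LogCombLandingLaw/…`):
statements as named propositions `Sig.stub_*` (same short names as the registered stubs, so the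
skeleton audit admits them as hypotheses); the registered stubs `stub_*` spell the signatures out
verbatim over importable declarations (`sorry` lives ONLY there).

## Negative knowledge honoured (read 2026-08-17; CITE when using this line)

* Landed Negative lemmas (p144764, imported above):
  `Summit.RiemannHypothesis.RiemannHypothesis.Theorems.displacementPencil_not_pencilDoubling_iff`
  (`¬PencilDoubling ↔ (∃ c ≥ 4, Hyp c) ∧ ¬PencilUnbounded`) and its corollaries: the crux AS FILED is
  "target-or-bust".  This line proves the STRONGER strict-doubling statement
  (`strictDoubling_of` below: `Hyp c → Hyp (2c)`), so its stubs are RUNG-BY-RUNG FINITELY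
  FALSIFIABLE — the refuter's recommended content-bearing form — and none of them is an instance of
  a landed Negative lemma (those refute nothing pointwise; they fix the logical shape).
* No `Cruxes/PencilDoubling/Disproof.lean` exists (`ledger crux ls`, 2026-08-17): no
  `_false_without_` theorem to honour yet.
* NUMERICAL STATUS (refuter crux-attack, item notes 06:22Z; evidence FLOODING.md,
  CERTIFIED-ZEROS.md, kit j023033/j023122 — numerical, 20-digit, NOT formal): close-pair FLOODING —
  `P_{c'}` has numerically certified non-real zero pairs for all 22 tested `c' ∈ [215, 65536]`,
  e.g. `P_256(44182.31200 ± 0.07237 i) = 0`, `P_512(37982.53418 ± 0.05842 i) = 0`,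
  `P_1024(80504.82242 ± 0.05212 i) = 0`; kill-window coverage predicts every `c' ≥ 185`
  non-hyperbolic and none `≤ 184`.  Consequences for THIS skeleton: instances with `c ≥ 185` are
  vacuous (`Hyp c` fails numerically); the live instances are `c ∈ [4, 184]`, and for
  `c ∈ (92, 184]` with `Hyp c` true one of `stub_low` / `stub_band` must fail numerically (the pair
  of `P_256` at height `44182 ≥ 128² = 16384` is a `stub_band` instance at `c = 128` IF `Hyp 128`
  holds; the pair of `P_512` at `37982 < 256²` would be a `stub_low` instance at `c = 256`, vacuous
  since `Hyp 256` fails).  Cheapest formal kill of the line: certify `Hyp c₀` for ONE `c₀ ∈ (92, 184]`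
  (a `PencilBase`-size ball-arithmetic certificate) and one non-real zero of `P_{2c₀}` — that refutes
  `stub_low` or `stub_band` outright, and with `¬PencilUnbounded` the crux itself
  (`displacementPencil_not_pencilDoubling_of_rung_of_not_pencilUnbounded`).  The registrar records
  this; repairing or retiring the node is the tenure planner's call (route KILL CRITERIA K2/K3).
-/

set_option linter.dupNamespace false

namespace Summit.RiemannHypothesis.RiemannHypothesis.Cruxes.PencilDoubling.Birth

open Summit.RiemannHypothesis.RiemannHypothesis.Theses.DisplacementPencil
  (PencilDoubling PencilUnbounded PencilBase HighReal)

/-! ## The three stub statements as named propositions `Sig.stub_*` -/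

namespace Sig

/-- **Stub 1 (LOW REGION / PINNING TRANSFER).** For `c ≥ 4` with `P_c` hyperbolic, every zero `z`
of `P_{2c} = 2c·Ξ + Ξ(·+i) + Ξ(·−i)` with `|Re z| < c²` is real.  The only stub that uses the rung
hypothesis `Hyp c` (pinning of both rungs to the zeros of `Ξ`; fails exactly when doubling carries
`c` into the kill window `(c_lo, c_hi)` of a flood-signed close pair — the refuter's flooding
mechanism).  Numerically threatened for `c ∈ (92, 184]` (see the module docstring). Size: open. -/
def stub_low : Prop :=
  ∀ c : ℝ, 4 ≤ c →
    Literature.NumberTheory.LFunctions.HasOnlyRealZeros (fun z : ℂ =>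
      (c : ℂ) * Literature.NumberTheory.LFunctions.riemannXiUpper z +
        Literature.NumberTheory.LFunctions.riemannXiUpper (z + Complex.I) +
        Literature.NumberTheory.LFunctions.riemannXiUpper (z - Complex.I)) →
    ∀ z : ℂ,
      ((2 * c : ℝ) : ℂ) * Literature.NumberTheory.LFunctions.riemannXiUpper z +
          Literature.NumberTheory.LFunctions.riemannXiUpper (z + Complex.I) +
          Literature.NumberTheory.LFunctions.riemannXiUpper (z - Complex.I) = 0 →
      |z.re| < c ^ 2 → z.im = 0

/-- **Stub 2 (CROSSOVER BAND below any certified dominance height).** For every `A : ℝ` such that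
all zeros of every rung `P_{c'}` (`c' ≥ 1`) with `|Re z| ≥ A·c'⁴` are real, and every `c ≥ 4` with
`P_c` hyperbolic: every zero `z` of `P_{2c}` with `c² ≤ |Re z| < A·(2c)⁴` is real.  (Equivalent to
"explicit dominance ⇒ all zeros of `P_{2c}` at heights `≥ c²` are real"; stated region-wise so the
composition is a plain trichotomy.)  Numerically clean for `c ≤ 32` ("band protection",
j020899/j021263); threatened at `c = 128` by the certified pair of `P_256` at height `44182` if
`Hyp 128` holds. Size: open. -/
def stub_band : Prop :=
  ∀ A : ℝ,
    (∀ c' : ℝ, 1 ≤ c' → ∀ z : ℂ,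
      (c' : ℂ) * Literature.NumberTheory.LFunctions.riemannXiUpper z +
          Literature.NumberTheory.LFunctions.riemannXiUpper (z + Complex.I) +
          Literature.NumberTheory.LFunctions.riemannXiUpper (z - Complex.I) = 0 →
      A * c' ^ 4 ≤ |z.re| → z.im = 0) →
    ∀ c : ℝ, 4 ≤ c →
      Literature.NumberTheory.LFunctions.HasOnlyRealZeros (fun z : ℂ =>
        (c : ℂ) * Literature.NumberTheory.LFunctions.riemannXiUpper z +
          Literature.NumberTheory.LFunctions.riemannXiUpper (z + Complex.I) +
          Literature.NumberTheory.LFunctions.riemannXiUpper (z - Complex.I)) →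
      ∀ z : ℂ,
        ((2 * c : ℝ) : ℂ) * Literature.NumberTheory.LFunctions.riemannXiUpper z +
            Literature.NumberTheory.LFunctions.riemannXiUpper (z + Complex.I) +
            Literature.NumberTheory.LFunctions.riemannXiUpper (z - Complex.I) = 0 →
        c ^ 2 ≤ |z.re| → |z.re| < A * (2 * c) ^ 4 → z.im = 0

/-- **Stub 3 (EXPLICIT DOMINANCE = the route's support item `HighReal`, verbatim).** There is `A`
such that for every `c ≥ 1` every zero `z` of `P_c` with `|Re z| ≥ A·c⁴` is real (displaced terms
dominate `c·Ξ` at every carrier extremum via `|ζ(1/2+it)| ≤ 0.618 t^{1/6} log t` or the convexity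
bound; the phase of `Ξ(t−i)` is strictly monotone there, so those zeros are real and simple).
Size: M/L (explicit estimates for `ζ` on `σ = 1/2, 3/2` are not in Mathlib). -/
def stub_highReal : Prop :=
  ∃ A : ℝ, ∀ c : ℝ, 1 ≤ c → ∀ z : ℂ,
    (c : ℂ) * Literature.NumberTheory.LFunctions.riemannXiUpper z +
        Literature.NumberTheory.LFunctions.riemannXiUpper (z + Complex.I) +
        Literature.NumberTheory.LFunctions.riemannXiUpper (z - Complex.I) = 0 →
    A * c ^ 4 ≤ |z.re| → z.im = 0

end Sig

/-! ## The registered stubs (full signatures spelled out verbatim; `sorry` lives only here) -/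

/-- Registered stub `stub_low` (= `Sig.stub_low`, spelled out so that a `Theorems/` proof can
restate it verbatim over importable declarations). -/
theorem stub_low :
    ∀ c : ℝ, 4 ≤ c →
    Literature.NumberTheory.LFunctions.HasOnlyRealZeros (fun z : ℂ =>
      (c : ℂ) * Literature.NumberTheory.LFunctions.riemannXiUpper z +
        Literature.NumberTheory.LFunctions.riemannXiUpper (z + Complex.I) +
        Literature.NumberTheory.LFunctions.riemannXiUpper (z - Complex.I)) →
    ∀ z : ℂ,
      ((2 * c : ℝ) : ℂ) * Literature.NumberTheory.LFunctions.riemannXiUpper z +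
          Literature.NumberTheory.LFunctions.riemannXiUpper (z + Complex.I) +
          Literature.NumberTheory.LFunctions.riemannXiUpper (z - Complex.I) = 0 →
      |z.re| < c ^ 2 → z.im = 0 := by
  sorry

/-- Registered stub `stub_band` (= `Sig.stub_band`, spelled out). -/
theorem stub_band :
    ∀ A : ℝ,
    (∀ c' : ℝ, 1 ≤ c' → ∀ z : ℂ,
      (c' : ℂ) * Literature.NumberTheory.LFunctions.riemannXiUpper z +
          Literature.NumberTheory.LFunctions.riemannXiUpper (z + Complex.I) +
          Literature.NumberTheory.LFunctions.riemannXiUpper (z - Complex.I) = 0 →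
      A * c' ^ 4 ≤ |z.re| → z.im = 0) →
    ∀ c : ℝ, 4 ≤ c →
      Literature.NumberTheory.LFunctions.HasOnlyRealZeros (fun z : ℂ =>
        (c : ℂ) * Literature.NumberTheory.LFunctions.riemannXiUpper z +
          Literature.NumberTheory.LFunctions.riemannXiUpper (z + Complex.I) +
          Literature.NumberTheory.LFunctions.riemannXiUpper (z - Complex.I)) →
      ∀ z : ℂ,
        ((2 * c : ℝ) : ℂ) * Literature.NumberTheory.LFunctions.riemannXiUpper z +
            Literature.NumberTheory.LFunctions.riemannXiUpper (z + Complex.I) +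
            Literature.NumberTheory.LFunctions.riemannXiUpper (z - Complex.I) = 0 →
        c ^ 2 ≤ |z.re| → |z.re| < A * (2 * c) ^ 4 → z.im = 0 := by
  sorry

/-- Registered stub `stub_highReal` (= `Sig.stub_highReal` = the route item `HighReal`, spelled
out). -/
theorem stub_highReal :
    ∃ A : ℝ, ∀ c : ℝ, 1 ≤ c → ∀ z : ℂ,
    (c : ℂ) * Literature.NumberTheory.LFunctions.riemannXiUpper z +
        Literature.NumberTheory.LFunctions.riemannXiUpper (z + Complex.I) +
        Literature.NumberTheory.LFunctions.riemannXiUpper (z - Complex.I) = 0 →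
    A * c ^ 4 ≤ |z.re| → z.im = 0 := by
  sorry

/-! ## Composition (sorry-free) and the skeleton theorem -/

/-- **Strict doubling from the three stubs** (the content-bearing, rung-by-rung falsifiable form
recommended by the refuter's shape analysis): for `c ≥ 4`, `Hyp c → Hyp (2c)`.  Trichotomy of
`|Re z|` against `c²` and the dominance height `A·(2c)⁴` of `stub_highReal`. -/
theorem strictDoubling_of (hhigh : Sig.stub_highReal) (hband : Sig.stub_band) (hlow : Sig.stub_low) :
    ∀ c : ℝ, 4 ≤ c →
      Literature.NumberTheory.LFunctions.HasOnlyRealZeros (fun z : ℂ =>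
        (c : ℂ) * Literature.NumberTheory.LFunctions.riemannXiUpper z +
          Literature.NumberTheory.LFunctions.riemannXiUpper (z + Complex.I) +
          Literature.NumberTheory.LFunctions.riemannXiUpper (z - Complex.I)) →
      Literature.NumberTheory.LFunctions.HasOnlyRealZeros (fun z : ℂ =>
        ((2 * c : ℝ) : ℂ) * Literature.NumberTheory.LFunctions.riemannXiUpper z +
          Literature.NumberTheory.LFunctions.riemannXiUpper (z + Complex.I) +
          Literature.NumberTheory.LFunctions.riemannXiUpper (z - Complex.I)) := by
  intro c hc hyp z hz
  obtain ⟨A, hA⟩ := hhigh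
  rcases lt_or_ge |z.re| (c ^ 2) with hlt | hge
  · exact hlow c hc hyp z hz hlt
  · rcases lt_or_ge |z.re| (A * (2 * c) ^ 4) with hlt' | hge'
    · exact hband A hA c hc hyp z hz hge hlt'
    · exact hA (2 * c) (by linarith) z hz hge'

/-- **Composition.** The three stub statements imply the crux
`Summit.RiemannHypothesis.RiemannHypothesis.Theses.DisplacementPencil.PencilDoubling` BY NAME:
take `c' := 2c` and apply `strictDoubling_of`. -/
theorem PencilDoubling_of (hhigh : Sig.stub_highReal) (hband : Sig.stub_band) (hlow : Sig.stub_low) :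
    PencilDoubling := by
  intro c hc hyp
  exact ⟨2 * c, le_rfl, strictDoubling_of hhigh hband hlow c hc hyp⟩

/-- **The skeleton**: the crux BY NAME from the three registered stubs (depends on `sorryAx` only
through `stub_*`). -/
theorem PencilDoubling_proof : PencilDoubling :=
  PencilDoubling_of stub_highReal stub_band stub_low

/-! ## Calibration (sorry-free) -/

/-- The registered stubs are literally the `Sig` propositions, and `Sig.stub_highReal` is literally
the route's support item `HighReal`. -/
example : (Sig.stub_highReal ↔ HighReal) ∧
    (Sig.stub_low ↔ (∀ c : ℝ, 4 ≤ c →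
    Literature.NumberTheory.LFunctions.HasOnlyRealZeros (fun z : ℂ =>
      (c : ℂ) * Literature.NumberTheory.LFunctions.riemannXiUpper z +
        Literature.NumberTheory.LFunctions.riemannXiUpper (z + Complex.I) +
        Literature.NumberTheory.LFunctions.riemannXiUpper (z - Complex.I)) →
    ∀ z : ℂ,
      ((2 * c : ℝ) : ℂ) * Literature.NumberTheory.LFunctions.riemannXiUpper z +
          Literature.NumberTheory.LFunctions.riemannXiUpper (z + Complex.I) +
          Literature.NumberTheory.LFunctions.riemannXiUpper (z - Complex.I) = 0 →
      |z.re| < c ^ 2 → z.im = 0)) :=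
  ⟨Iff.rfl, Iff.rfl⟩

/-- Calibration against the landed Negative lemmas: the stub set is target-or-bust exactly like
the crux — given the base rung `PencilBase`, failure of the route target `PencilUnbounded` refutes
the conjunction of the three stubs (so a refuter attacks `stub_low`/`stub_band` rung by rung, and a
certified bounded hyperbolic set kills the line). -/
example (hbase : PencilBase) (hbust : ¬ PencilUnbounded) :
    ¬ (Sig.stub_highReal ∧ Sig.stub_band ∧ Sig.stub_low) := fun h =>
  Summit.RiemannHypothesis.RiemannHypothesis.Theorems.displacementPencil_not_pencilDoubling_of_pencilBase_of_not_pencilUnbounded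
    hbase hbust (PencilDoubling_of h.1 h.2.1 h.2.2)

/-- Calibration: conversely the crux gives back nothing region-wise — but strict doubling plus the
base rung rebuilds the route target (so the line, if it closed, would decide the route's `closes`
hypotheses with `PencilBase`). -/
example (hhigh : Sig.stub_highReal) (hband : Sig.stub_band) (hlow : Sig.stub_low)
    (hbase : PencilBase) : PencilUnbounded := by
  by_contra hbust
  exact Summit.RiemannHypothesis.RiemannHypothesis.Theorems.displacementPencil_not_pencilDoubling_of_pencilBase_of_not_pencilUnbounded
    hbase hbust (PencilDoubling_of hhigh hband hlow)

end Summit.RiemannHypothesis.RiemannHypothesis.Cruxes.PencilDoubling.Birth
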